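/-
COR-CM (cell pub-hodgecm2, stage 2 of the Hodge ladder) — count-neutral KERNEL COMBINATORICS «field level of the SYLOW TRANSFER: every Galois CM field
of degree ≡ 4 (mod 8) — hence every Galois CM field whose degree is NOT divisible by 8 — has EXACTLY φ₂(F) generating faces; a CM subfield of degree
≡ 2 (mod 4) yields an imaginary quadratic subfield; cyclic Sylow 2-subgroups» (seat prover-pub-hodgecm2-b23-g51-0, binder prover b23, gen 51; own
census lane SYLOW TRANSFER, claim HOME/INBOX.md l.23329).  Theorems only; `Census/SylowTransfer{Complement,Cyclic,FourOdd}.lean` (this seat), seat b23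
gen 40ʼs complement dictionary (`CorCM/FaceComplementGeneration.lean`, `CorCM/FaceComplementImaginaryQuadratic.lean`), the field transfer
`CorCM/FaceGenerationTransfer.lean` and the INT2-GEN socket are used BY NAME; nothing asserted.  `Interfaces.lean` (C1), every E term, B01,
`Transposition/*`, `PortJoin/*`, `D2Bridge/*` untouched.
HONEST FRAMING: `HC_CM` is NOT proved, here or anywhere in the tree; this file produces no period and proves no face period for any field; §3 is
CONDITIONAL on the face periods exactly as the earlier sockets.
T5: n/a-class (hypothesis binders: `8 ∤ [F:ℚ]` / `[F:ℚ] = 4m, m odd` / a subfield `L` with `[L:ℚ] % 4 = 2` and a non-real element / an automorphism of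
order `2ᵏ` with `[F:ℚ] = 2ᵏ·m`, `m` odd `> 1` — inhabited by `ℚ(ζ₅, √−3)`-type fields, `ℚ(ζ₁₆)·L`, …; checker: self, 2026-08-25).
-/
import Summits.HodgeConjecture.CorCM.Census.SylowTransferFourOdd
import Summits.HodgeConjecture.CorCM.FaceIndexTwoCyclicSmallDegrees
import HarnessLib

/-!
# Field level of the Sylow transfer: every Galois CM field whose degree is not divisible by `8` has exactly `φ₂(F)` generating faces

The face census `μ = φ₂` (the least number of faces whose Galois conjugates generate the Lefschetz/Hodge lattice modulo divisor classes equals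
André-3ʼs coinvariant fibre dimension `φ₂`) is here a theorem for the following classes of Galois CM fields `F`, with NO hypothesis on the
Galois group and NO datum beyond a base embedding `σ₀`:

* §1 **`8 ∤ [F:ℚ]`** (**`isLeast_card_faces_hgen_of_not_eight_dvd_finrank`**; `[F:ℚ] ≡ 2 (mod 4)`: gen 40, complex conjugation is complemented by the
  sign of the regular representation; `[F:ℚ] ≡ 4 (mod 8)`: `Census/SylowTransferFourOdd.lean` — a Sylow `2`-subgroup of the Galois translates has
  order `4`; if it is `ℤ/2 × ℤ/2` the COSET SIGN of a second involution complements conjugation, if it is `ℤ/4` BURNSIDE's transfer feeds seat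
  b09ʼs CYCLIC-SYLOW LAW); the forms `…_of_finrank_eq_four_mul_odd`, `…_of_finrank_mod_eight`.
* §1 **a CM subfield of degree `≡ 2 (mod 4)`** (**`isLeast_card_faces_hgen_of_subfield_mod_four`**): `L ⊆ F` with `[L:ℚ] ≡ 2 (mod 4)` containing a
  non-real element ⟹ EXACTLY `φ₂(F)` faces; indeed (**`exists_imaginary_quadratic_subfield_of_subfield_mod_four`**, the COSET SIGN read through gen
  40ʼs dictionary) such an `F` CONTAINS AN IMAGINARY QUADRATIC FIELD.
* §2 **cyclic Sylow `2`-subgroup** (**`isLeast_card_faces_hgen_of_aut_orderOf_eq_two_pow`**): `[F:ℚ] = 2ᵏ·m` with `m > 1` odd, `k ≥ 2`, and an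
  automorphism of order `2ᵏ` ⟹ EXACTLY `φ₂(F) = β(F) − 1` faces.
§3 records the CONDITIONAL Hodge-conjecture readings through the INT2-GEN socket.  `HC_CM` is NOT proved.

## References
* [Pohlmann1968] H. Pohlmann, Algebraic cycles on abelian varieties of complex multiplication type, Ann. of Math. 88 (1968), Thm 1.
* [Shimura1998] G. Shimura, Abelian Varieties with Complex Multiplication and Modular Functions, §6.2 Thm. 3, §8.1.
-/

noncomputable section

open CategoryTheory NumberField NumberField.ComplexEmbedding
open Literature.AlgebraicGeometry Literature.AlgebraicGeometry.Motives Literature.AlgebraicGeometry.HodgeTheory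
open Literature.AlgebraicGeometry.ComplexMultiplication Literature.AlgebraicGeometry.Milne1999
open Literature.NumberTheory.Automorphic
open Literature.NumberTheory.Automorphic.PicardCM
open Summit.HodgeConjecture.CorCM.Domination

namespace Summit.HodgeConjecture.CorCM.FaceSylowTransfer

open Summit.HodgeConjecture.CorCM.Prior.AllgGroup.RfwfAllgGroup
open Summit.HodgeConjecture.CorCM.Census.BlockParity
open Summit.HodgeConjecture.CorCM.Census.Coinvariant
open Summit.HodgeConjecture.CorCM.Census
open Summit.HodgeConjecture.CorCM.FaceCensus.OddSlice (galTOfAut galTOfAut_mul galTOfAut_conjAut)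

section Field

variable {F : Type} [Field F] [NumberField F]

/-! ## §1 Exactly `φ₂(F)` generating faces: degree not divisible by `8`; a CM subfield of degree `≡ 2 (mod 4)` -/

/-- Transfer of an intrinsic `μ = φ₂` law on the Galois translates to the face sets of `F` (file-local wrapper of `CorCM/FaceGenerationTransfer.lean`).
[folklore] -/
private theorem isLeast_faces_of_isLeast_gfaces [IsCMField F] [IsGalois ℚ F]
    (h : IsLeast {m : ℕ | ∃ S : Finset (CMF (GalT F) conjT →₀ ℤ), ↑S ⊆ gfaceSet (GalT F) conjT conjT_mul_self ∧ S.card = m ∧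
      hodgeSpan (conjT : GalT F) conjT_mul_self ≤ Submodule.span ℤ (pairSet (conjT : GalT F)) ⊔ Submodule.span ℤ (translates conjT S)}
      (fibreTwo (conjT : GalT F) conjT_mul_self)) (σ₀ : F →+* ℂ) :
    IsLeast {m : ℕ | ∃ 𝒮 : Finset (Face F), 𝒮.card = m ∧
      ∀ f : Face F, lefChar f.corner (fun _ => ({σ₀} : Finset (F →+* ℂ))) ∈ AddSubgroup.closure
        {a : Asym F | ∃ g ∈ (𝒮 : Set (Face F)), ∃ σ : F →+* ℂ, a = lefChar g.corner (fun _ => ({σ} : Finset (F →+* ℂ)))}}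
      (fibreTwo (conjT : GalT F) conjT_mul_self) := by
  refine FaceTransfer.isLeast_card_faces_hgen_of_intrinsic _ ?_ (fun S₀ hS₀ hS => ?_) σ₀
  · obtain ⟨S, hS, hcard, hgen⟩ := h.1
    exact ⟨S, hS, hcard.le, hgen⟩
  · exact fibreTwo_le_card conjT conjT_mul_self FaceBasis.conjT_comm S₀ (Submodule.span ℤ (pairSet conjT)) le_rfl hS₀
      (fun y hy => hS (gfaceSet_subset_hodgeSpan conjT conjT_mul_self hy))

/-- **EVERY GALOIS CM FIELD WHOSE DEGREE IS NOT DIVISIBLE BY `8` HAS EXACTLY `φ₂(F)` GENERATING FACES** — no hypothesis on the Galois group,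
complex conjugation any central involution, no datum beyond `σ₀`. [folklore] -/
theorem isLeast_card_faces_hgen_of_not_eight_dvd_finrank [IsCMField F] [IsGalois ℚ F] (h8 : ¬ 8 ∣ Module.finrank ℚ F) (σ₀ : F →+* ℂ) :
    IsLeast {m : ℕ | ∃ 𝒮 : Finset (Face F), 𝒮.card = m ∧
      ∀ f : Face F, lefChar f.corner (fun _ => ({σ₀} : Finset (F →+* ℂ))) ∈ AddSubgroup.closure
        {a : Asym F | ∃ g ∈ (𝒮 : Set (Face F)), ∃ σ : F →+* ℂ, a = lefChar g.corner (fun _ => ({σ} : Finset (F →+* ℂ)))}}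
      (fibreTwo (conjT : GalT F) conjT_mul_self) :=
  isLeast_faces_of_isLeast_gfaces (SylowTransfer.isLeast_card_gfaces_generate_fibreTwo_of_not_eight_dvd conjT
    (by rwa [FaceCensus.card_galT (F := F)]) conjT_mul_self conjT_ne_one FaceBasis.conjT_comm) σ₀

/-- **EVERY GALOIS CM FIELD OF DEGREE `4·odd` HAS EXACTLY `φ₂(F)` GENERATING FACES.** [folklore] -/
theorem isLeast_card_faces_hgen_of_finrank_eq_four_mul_odd [IsCMField F] [IsGalois ℚ F] {m : ℕ} (hdeg : Module.finrank ℚ F = 4 * m)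
    (hm : Odd m) (σ₀ : F →+* ℂ) :
    IsLeast {n : ℕ | ∃ 𝒮 : Finset (Face F), 𝒮.card = n ∧
      ∀ f : Face F, lefChar f.corner (fun _ => ({σ₀} : Finset (F →+* ℂ))) ∈ AddSubgroup.closure
        {a : Asym F | ∃ g ∈ (𝒮 : Set (Face F)), ∃ σ : F →+* ℂ, a = lefChar g.corner (fun _ => ({σ} : Finset (F →+* ℂ)))}}
      (fibreTwo (conjT : GalT F) conjT_mul_self) :=
  isLeast_faces_of_isLeast_gfaces (SylowTransfer.isLeast_card_gfaces_generate_fibreTwo_of_card_eq_four_mul_odd conjT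
    ((FaceCensus.card_galT (F := F)).trans hdeg) hm conjT_mul_self conjT_ne_one FaceBasis.conjT_comm) σ₀

/-- **EVERY GALOIS CM FIELD OF DEGREE `≡ 4 (mod 8)` HAS EXACTLY `φ₂(F)` GENERATING FACES.** [folklore] -/
theorem isLeast_card_faces_hgen_of_finrank_mod_eight [IsCMField F] [IsGalois ℚ F] (hdeg : Module.finrank ℚ F % 8 = 4) (σ₀ : F →+* ℂ) :
    IsLeast {n : ℕ | ∃ 𝒮 : Finset (Face F), 𝒮.card = n ∧
      ∀ f : Face F, lefChar f.corner (fun _ => ({σ₀} : Finset (F →+* ℂ))) ∈ AddSubgroup.closure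
        {a : Asym F | ∃ g ∈ (𝒮 : Set (Face F)), ∃ σ : F →+* ℂ, a = lefChar g.corner (fun _ => ({σ} : Finset (F →+* ℂ)))}}
      (fibreTwo (conjT : GalT F) conjT_mul_self) :=
  isLeast_card_faces_hgen_of_not_eight_dvd_finrank (by omega) σ₀

/-- The index of the fixing subgroup of a subfield of a Galois extension is the degree of the subfield. [folklore] -/
theorem index_fixingSubgroup_eq [IsGalois ℚ F] (L : IntermediateField ℚ F) : L.fixingSubgroup.index = Module.finrank ℚ L := by
  have h1 : L.fixingSubgroup.index * Nat.card L.fixingSubgroup = Nat.card (F ≃ₐ[ℚ] F) := L.fixingSubgroup.index_mul_card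
  rw [IsGalois.card_fixingSubgroup_eq_finrank L, IsGalois.card_aut_eq_finrank, ← Module.finrank_mul_finrank ℚ L F] at h1
  exact Nat.eq_of_mul_eq_mul_right Module.finrank_pos h1

/-- **A subfield of degree `≡ 2 (mod 4)` with a non-real element gives a subgroup of index `≡ 2 (mod 4)` of the Galois translates missing
`conjT`** (its fixing subgroup, read through `galTOfAut σ₀`). [folklore] -/
theorem exists_subgroup_index_mod_four_of_subfield [IsCMField F] [IsGalois ℚ F] (σ₀ : F →+* ℂ) (L : IntermediateField ℚ F)
    (hL : Module.finrank ℚ L % 4 = 2) (hx : ∃ x ∈ L, (σ₀ x).im ≠ 0) :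
    ∃ K : Subgroup (GalT F), conjT ∉ K ∧ K.index % 4 = 2 := by
  obtain ⟨c, hc⟩ := FaceCensus.exists_conjAut σ₀
  set e : (F ≃ₐ[ℚ] F) ≃* GalT F := MulEquiv.mk' (galTOfAut σ₀) (galTOfAut_mul σ₀) with he
  have hec : e c = conjT := by rw [he]; exact galTOfAut_conjAut σ₀ hc
  refine ⟨L.fixingSubgroup.map (e : (F ≃ₐ[ℚ] F) →* GalT F), fun hmem => ?_, ?_⟩
  · rw [← hec] at hmem
    obtain ⟨g, hg, hge⟩ := Subgroup.mem_map.mp hmem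
    have hgc : g = c := e.injective hge
    rw [hgc] at hg
    obtain ⟨x, hxL, hxim⟩ := hx
    have hfix : c x = x := (IntermediateField.mem_fixingSubgroup_iff L c).mp hg x hxL
    have h1 : σ₀ (c x) = starRingEnd ℂ (σ₀ x) := by
      have := RingHom.congr_fun hc x
      simpa [conjugate_coe_eq] using this
    rw [hfix] at h1
    have h2 := congrArg Complex.im h1
    rw [Complex.conj_im] at h2
    exact hxim (by linarith)
  · rw [Subgroup.index_map_equiv, index_fixingSubgroup_eq L, hL]

/-- **A GALOIS CM FIELD CONTAINING A CM SUBFIELD OF DEGREE `≡ 2 (mod 4)` CONTAINS AN IMAGINARY QUADRATIC FIELD** — `L ⊆ F`, `[L:ℚ] ≡ 2 (mod 4)`,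
`L` not fixed by complex conjugation ⟹ `F ⊇ ℚ(√−d)` (the coset sign of `Census/SylowTransferComplement.lean` read through gen 40ʼs dictionary
`FaceComplement.exists_imaginary_quadratic_subfield_of_cpl`; `L` itself need not be Galois). [folklore] -/
theorem exists_imaginary_quadratic_subfield_of_subfield_mod_four [IsCMField F] [IsGalois ℚ F] (σ₀ : F →+* ℂ) (L : IntermediateField ℚ F)
    (hL : Module.finrank ℚ L % 4 = 2) (hx : ∃ x ∈ L, (σ₀ x).im ≠ 0) :
    ∃ E : IntermediateField ℚ F, Module.finrank ℚ E = 2 ∧ ∃ x ∈ E, (σ₀ x).im ≠ 0 := by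
  obtain ⟨K, hcK, hK⟩ := exists_subgroup_index_mod_four_of_subfield σ₀ L hL hx
  obtain ⟨A, hA⟩ := SylowTransfer.exists_cpl_of_index_mod_four conjT K conjT_mul_self FaceBasis.conjT_comm hcK hK
  exact FaceComplement.exists_imaginary_quadratic_subfield_of_cpl σ₀ hA

/-- **A GALOIS CM FIELD WITH A CM SUBFIELD OF DEGREE `≡ 2 (mod 4)` HAS EXACTLY `φ₂(F)` GENERATING FACES** (`Gal(F/ℚ)` otherwise arbitrary).
[folklore] -/
theorem isLeast_card_faces_hgen_of_subfield_mod_four [IsCMField F] [IsGalois ℚ F] (σ₀ : F →+* ℂ) (L : IntermediateField ℚ F)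
    (hL : Module.finrank ℚ L % 4 = 2) (hx : ∃ x ∈ L, (σ₀ x).im ≠ 0) :
    IsLeast {n : ℕ | ∃ 𝒮 : Finset (Face F), 𝒮.card = n ∧
      ∀ f : Face F, lefChar f.corner (fun _ => ({σ₀} : Finset (F →+* ℂ))) ∈ AddSubgroup.closure
        {a : Asym F | ∃ g ∈ (𝒮 : Set (Face F)), ∃ σ : F →+* ℂ, a = lefChar g.corner (fun _ => ({σ} : Finset (F →+* ℂ)))}}
      (fibreTwo (conjT : GalT F) conjT_mul_self) := by
  obtain ⟨K, hcK, hK⟩ := exists_subgroup_index_mod_four_of_subfield σ₀ L hL hx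
  exact isLeast_faces_of_isLeast_gfaces (SylowTransfer.isLeast_card_gfaces_generate_fibreTwo_of_index_mod_four conjT K hcK hK
    conjT_mul_self conjT_ne_one FaceBasis.conjT_comm) σ₀

/-- **Subgroup form**: a subgroup `K` of the Galois translates of index `≡ 2 (mod 4)` missing `conjT` ⟹ EXACTLY `φ₂(F)` generating faces. [folklore] -/
theorem isLeast_card_faces_hgen_of_index_mod_four [IsCMField F] [IsGalois ℚ F] (K : Subgroup (GalT F)) (hcK : conjT ∉ K)
    (hK : K.index % 4 = 2) (σ₀ : F →+* ℂ) :
    IsLeast {n : ℕ | ∃ 𝒮 : Finset (Face F), 𝒮.card = n ∧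
      ∀ f : Face F, lefChar f.corner (fun _ => ({σ₀} : Finset (F →+* ℂ))) ∈ AddSubgroup.closure
        {a : Asym F | ∃ g ∈ (𝒮 : Set (Face F)), ∃ σ : F →+* ℂ, a = lefChar g.corner (fun _ => ({σ} : Finset (F →+* ℂ)))}}
      (fibreTwo (conjT : GalT F) conjT_mul_self) :=
  isLeast_faces_of_isLeast_gfaces (SylowTransfer.isLeast_card_gfaces_generate_fibreTwo_of_index_mod_four conjT K hcK hK
    conjT_mul_self conjT_ne_one FaceBasis.conjT_comm) σ₀

/-! ## §2 Cyclic Sylow `2`-subgroups: an automorphism of order the `2`-part of the degree -/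

/-- **CYCLIC SYLOW `2`-SUBGROUP, element form on the Galois translates**: `[F:ℚ] = 2ᵏ·m`, `m > 1` odd, `k ≥ 2`, `u : GalT F` of order `2ᵏ` ⟹ EXACTLY
`φ₂(F)` generating faces, and `φ₂(F) + 1 = β(F)`. [folklore] -/
theorem isLeast_card_faces_hgen_of_orderOf_eq_two_pow [IsCMField F] [IsGalois ℚ F] {k m : ℕ} (u : GalT F) (hu : orderOf u = 2 ^ k) (hk : 2 ≤ k)
    (hdeg : Module.finrank ℚ F = 2 ^ k * m) (hm : Odd m) (hm1 : m ≠ 1) (σ₀ : F →+* ℂ) :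
    IsLeast {n : ℕ | ∃ 𝒮 : Finset (Face F), 𝒮.card = n ∧
      ∀ f : Face F, lefChar f.corner (fun _ => ({σ₀} : Finset (F →+* ℂ))) ∈ AddSubgroup.closure
        {a : Asym F | ∃ g ∈ (𝒮 : Set (Face F)), ∃ σ : F →+* ℂ, a = lefChar g.corner (fun _ => ({σ} : Finset (F →+* ℂ)))}}
      (fibreTwo (conjT : GalT F) conjT_mul_self) ∧
    fibreTwo (conjT : GalT F) conjT_mul_self + 1 = Fintype.card (Block (conjT : GalT F)) := by
  have h := SylowTransfer.isLeast_card_gfaces_generate_fibreTwo_of_orderOf_eq_two_pow conjT u hu hk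
    ((FaceCensus.card_galT (F := F)).trans hdeg) hm hm1 conjT_mul_self conjT_ne_one FaceBasis.conjT_comm
  exact ⟨isLeast_faces_of_isLeast_gfaces h.1 σ₀, h.2⟩

/-- **CYCLIC SYLOW `2`-SUBGROUP, automorphism form**: `[F:ℚ] = 2ᵏ·m`, `m > 1` odd, `k ≥ 2`, and an automorphism `u₀ ∈ Aut(F)` of order `2ᵏ` ⟹
EXACTLY `φ₂(F)` generating faces, `φ₂(F) + 1 = β(F)` (e.g. `F = K·L` with `K` Galois CM cyclic of degree `2ᵏ` and `L` totally real of odd degree,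
Galois or not over `ℚ` inside a Galois `F`, `Gal(F/ℚ) = N ⋊ ℤ/2ᵏ`). [folklore] -/
theorem isLeast_card_faces_hgen_of_aut_orderOf_eq_two_pow [IsCMField F] [IsGalois ℚ F] (σ₀ : F →+* ℂ) {k m : ℕ} (u₀ : F ≃ₐ[ℚ] F)
    (hu₀ : orderOf u₀ = 2 ^ k) (hk : 2 ≤ k) (hdeg : Module.finrank ℚ F = 2 ^ k * m) (hm : Odd m) (hm1 : m ≠ 1) :
    IsLeast {n : ℕ | ∃ 𝒮 : Finset (Face F), 𝒮.card = n ∧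
      ∀ f : Face F, lefChar f.corner (fun _ => ({σ₀} : Finset (F →+* ℂ))) ∈ AddSubgroup.closure
        {a : Asym F | ∃ g ∈ (𝒮 : Set (Face F)), ∃ σ : F →+* ℂ, a = lefChar g.corner (fun _ => ({σ} : Finset (F →+* ℂ)))}}
      (fibreTwo (conjT : GalT F) conjT_mul_self) ∧
    fibreTwo (conjT : GalT F) conjT_mul_self + 1 = Fintype.card (Block (conjT : GalT F)) := by
  set e : (F ≃ₐ[ℚ] F) ≃* GalT F := MulEquiv.mk' (galTOfAut σ₀) (galTOfAut_mul σ₀) with he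
  have hord : orderOf (e u₀) = 2 ^ k := by
    rw [← hu₀]; exact orderOf_injective e.toMonoidHom e.injective u₀
  exact isLeast_card_faces_hgen_of_orderOf_eq_two_pow (e u₀) hord hk hdeg hm hm1 σ₀

end Field

/-! ## §3 The Hodge-conjecture readings through the INT2-GEN socket (conditional on the face periods) -/

/-- **HC for the slice of ANY Galois CM field of degree `≥ 6` not divisible by `8`, from `φ₂(K)` face periods** (INT2-GEN socket BY NAME; CONDITIONAL
on the periods — `HC_CM` is NOT proved; no hypothesis on the Galois group): a face set with `|𝒮| = φ₂(K)` EXISTS (none smaller satisfies the generation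
binder) such that ONE period witness per face of `𝒮` on the universe of record implies the Hodge conjecture for every abelian variety dominated by a
product of CM abelian varieties with CM by subfields of `K`. [cite: Shimura1998, §6.2 Theorem 3 and §6.1 Corollary of Theorem 2 (pp. 41–43)]
[cite: Pohlmann1968, Thm. 1] [cite: Milne1999LefschetzClasses, Thm. 3.2 and Cor. 4.5] [cite: MumfordAV1970, §19 Thm. 1 and p. 169] -/
theorem hodgeConjectureFor_of_not_eight_dvd_finrank_of_exists_facePeriod (K : CMField) [hGal : IsGalois ℚ K] (h6 : 6 ≤ Module.finrank ℚ K)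
    (h8 : ¬ 8 ∣ Module.finrank ℚ K) (σ₀ : (K : Type) →+* ℂ) :
    ∃ 𝒮 : Finset (Face K), 𝒮.card = fibreTwo (conjT : GalT K) conjT_mul_self ∧
      ((∀ f ∈ 𝒮, ∃ ι₁ : K →+* ℂ, f.Admissible ι₁ ∧ ∃ (V : HermSpace3 K ι₁) (σ : K →+* ℂ),
        (Model.picardCMUniverse exists_isReal_hodgeModel_holds hodgePQ_independent_of_hodgeModel_holds
          BallQuotient.ballQuotientUniformised_holds cmAbelianVarietyRealised_holds).PeriodNV ι₁ V K f.psi σ) →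
      ∀ {P B : AbelianVariety ℂ}, AbelianVariety.IsProductOf (fun B : AbelianVariety ℂ =>
        ∃ (E : Type) (_ : Field E) (_ : NumberField E) (_ : IsCMField E) (_ : E →+* (K : Type)) (Φ : CMType E)
          (ι : 𝓞 E →+* End B) (ϑ : E →+* Module.End ℂ (complexBetti B.X 1)),
          IsCMTypeRealisation Φ B ι ϑ) P →
      AVDominatedBy B P → HodgeConjectureFor B.dim B.X) := by
  obtain ⟨⟨𝒮, hcard, hgen⟩, -⟩ := isLeast_card_faces_hgen_of_not_eight_dvd_finrank (F := K) h8 σ₀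
  refine ⟨𝒮, hcard, fun h P B hP hB => ?_⟩
  exact hodgeConjectureFor_of_avDominatedBy_isProductOf_of_exists_facePeriod_on K h6 (𝒮 : Set (Face K)) σ₀ hgen
    (fun f hf => h f (Finset.mem_coe.mp hf)) hP hB

/-- **HC for the slice of a Galois CM field with a CM subfield of degree `≡ 2 (mod 4)`, from `φ₂(K)` face periods** (CONDITIONAL; `HC_CM` is NOT
proved). [cite: Shimura1998, §6.2 Theorem 3 and §6.1 Corollary of Theorem 2 (pp. 41–43)] [cite: Pohlmann1968, Thm. 1]
[cite: Milne1999LefschetzClasses, Thm. 3.2 and Cor. 4.5] [cite: MumfordAV1970, §19 Thm. 1 and p. 169] -/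
theorem hodgeConjectureFor_of_subfield_mod_four_of_exists_facePeriod (K : CMField) [hGal : IsGalois ℚ K] (h6 : 6 ≤ Module.finrank ℚ K)
    (σ₀ : (K : Type) →+* ℂ) (L : IntermediateField ℚ K) (hL : Module.finrank ℚ L % 4 = 2) (hx : ∃ x ∈ L, (σ₀ x).im ≠ 0) :
    ∃ 𝒮 : Finset (Face K), 𝒮.card = fibreTwo (conjT : GalT K) conjT_mul_self ∧
      ((∀ f ∈ 𝒮, ∃ ι₁ : K →+* ℂ, f.Admissible ι₁ ∧ ∃ (V : HermSpace3 K ι₁) (σ : K →+* ℂ),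
        (Model.picardCMUniverse exists_isReal_hodgeModel_holds hodgePQ_independent_of_hodgeModel_holds
          BallQuotient.ballQuotientUniformised_holds cmAbelianVarietyRealised_holds).PeriodNV ι₁ V K f.psi σ) →
      ∀ {P B : AbelianVariety ℂ}, AbelianVariety.IsProductOf (fun B : AbelianVariety ℂ =>
        ∃ (E : Type) (_ : Field E) (_ : NumberField E) (_ : IsCMField E) (_ : E →+* (K : Type)) (Φ : CMType E)
          (ι : 𝓞 E →+* End B) (ϑ : E →+* Module.End ℂ (complexBetti B.X 1)),
          IsCMTypeRealisation Φ B ι ϑ) P →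
      AVDominatedBy B P → HodgeConjectureFor B.dim B.X) := by
  obtain ⟨⟨𝒮, hcard, hgen⟩, -⟩ := isLeast_card_faces_hgen_of_subfield_mod_four (F := K) σ₀ L hL hx
  refine ⟨𝒮, hcard, fun h P B hP hB => ?_⟩
  exact hodgeConjectureFor_of_avDominatedBy_isProductOf_of_exists_facePeriod_on K h6 (𝒮 : Set (Face K)) σ₀ hgen
    (fun f hf => h f (Finset.mem_coe.mp hf)) hP hB

/-- **HC for the slice of a Galois CM field with a cyclic Sylow `2`-subgroup (an automorphism of order the `2`-part `2ᵏ ≥ 4` of the degree, odd part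
`> 1`), from `φ₂(K) = β(K) − 1` face periods** (CONDITIONAL; `HC_CM` is NOT proved). [cite: Shimura1998, §6.2 Theorem 3 and §6.1 Corollary of Theorem 2
(pp. 41–43)] [cite: Pohlmann1968, Thm. 1] [cite: Milne1999LefschetzClasses, Thm. 3.2 and Cor. 4.5] [cite: MumfordAV1970, §19 Thm. 1 and p. 169] -/
theorem hodgeConjectureFor_of_aut_orderOf_eq_two_pow_of_exists_facePeriod (K : CMField) [hGal : IsGalois ℚ K] (σ₀ : (K : Type) →+* ℂ)
    {k m : ℕ} (u₀ : (K : Type) ≃ₐ[ℚ] (K : Type)) (hu₀ : orderOf u₀ = 2 ^ k) (hk : 2 ≤ k) (hdeg : Module.finrank ℚ K = 2 ^ k * m)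
    (hm : Odd m) (hm1 : m ≠ 1) :
    ∃ 𝒮 : Finset (Face K), 𝒮.card + 1 = Fintype.card (Block (conjT : GalT K)) ∧
      ((∀ f ∈ 𝒮, ∃ ι₁ : K →+* ℂ, f.Admissible ι₁ ∧ ∃ (V : HermSpace3 K ι₁) (σ : K →+* ℂ),
        (Model.picardCMUniverse exists_isReal_hodgeModel_holds hodgePQ_independent_of_hodgeModel_holds
          BallQuotient.ballQuotientUniformised_holds cmAbelianVarietyRealised_holds).PeriodNV ι₁ V K f.psi σ) →
      ∀ {P B : AbelianVariety ℂ}, AbelianVariety.IsProductOf (fun B : AbelianVariety ℂ =>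
        ∃ (E : Type) (_ : Field E) (_ : NumberField E) (_ : IsCMField E) (_ : E →+* (K : Type)) (Φ : CMType E)
          (ι : 𝓞 E →+* End B) (ϑ : E →+* Module.End ℂ (complexBetti B.X 1)),
          IsCMTypeRealisation Φ B ι ϑ) P →
      AVDominatedBy B P → HodgeConjectureFor B.dim B.X) := by
  obtain ⟨⟨⟨𝒮, hcard, hgen⟩, -⟩, hβ⟩ := isLeast_card_faces_hgen_of_aut_orderOf_eq_two_pow (F := K) σ₀ u₀ hu₀ hk hdeg hm hm1
  refine ⟨𝒮, by rw [hcard, hβ], fun h P B hP hB => ?_⟩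
  have h6 : 6 ≤ Module.finrank ℚ K := by
    rw [hdeg]
    have h4 : 4 ≤ 2 ^ k := by
      calc 4 = 2 ^ 2 := by norm_num
        _ ≤ 2 ^ k := Nat.pow_le_pow_right (by norm_num) hk
    obtain ⟨j, rfl⟩ := hm
    have hj : 1 ≤ j := by
      by_contra hj0
      exact hm1 (by omega)
    nlinarith
  exact hodgeConjectureFor_of_avDominatedBy_isProductOf_of_exists_facePeriod_on K h6 (𝒮 : Set (Face K)) σ₀ hgen
    (fun f hf => h f (Finset.mem_coe.mp hf)) hP hB

end Summit.HodgeConjecture.CorCM.FaceSylowTransfer
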